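import Literature.NumberTheory.Automorphic.GelbartJacquetAdjointLiftArchimedean
import Literature.NumberTheory.Automorphic.StrongMultiplicityOneRepDataAE
import Literature.NumberTheory.Automorphic.BaseChangeArchimedeanUnitaryReduction
import Literature.NumberTheory.Automorphic.GL2ArchParameterOfEigenform
import Literature.NumberTheory.Automorphic.NewformAutomorphicRepSatake
import Literature.NumberTheory.Automorphic.NewformAdelisationAutomorphicForm
import HarnessLib

/-!
# The archimedean parameter of the automorphic representation of a holomorphic newform:
# reduction of `newform_archParameter` to strong multiplicity one for `GL₂` (proofs)

Topic `NumberTheory/Automorphic`; a proof file (theorems only: no definition, no named fact, no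
instance) for the named fact `Literature.NumberTheory.Automorphic.newform_archParameter` of
`Literature.NumberTheory.Automorphic.GelbartJacquetAdjointLiftArchimedean` (whose sibling
`GelbartJacquetAdjointLiftArchimedeanProofs` serves the other fact of that file, the adjoint lift) (Gelbart 1997, §2.5,
Proposition (c) with Remark 2.5.2 and Fact 2.2; Gelbart 1975, Thm. 5.19; the independence of the
realisation is strong multiplicity one, Jacquet–Shalika 1981, Thm. 4.4): *for a newform
`f ∈ S_k(Γ₁(N))`, `k ≥ 2`, every cuspidal automorphic representation datum `π = W / W'` of
`GL₂(𝔸_ℚ)` (Borel–Jacquet 1979, 4.6) whose Satake parameter at almost every `p` is the unitary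
Satake pair `{α, β}` of `f` has archimedean parameter `{(k-1)/2, (1-k)/2}`*.

The printed proof has two halves, and this file follows it.

1. **The dictionary `f ↦ π_f` at the archimedean place** (Gelbart 1997, Prop. 2.5 (c), (2.5.4) (v),
   Remark 2.5.2; Gelbart 1975, §3 and Thm. 5.19). The adelic lift `φ_f` of `f` is a cusp form on
   `GL₂(𝔸_ℚ)` in Borel–Jacquet's sense (the tree's `adelicLiftFunA_mem_cuspFormsGL` of
   `NewformAdelisationAutomorphicForm`), killed by the lowering operator, with `Z φ_f = 0` and Casimir
   eigenvalue `((k-1)/2)² + ((1-k)/2)² - ½`; so a cuspidal datum `P = W_f / W_f'` containing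
   `φ_f ∈ W_f ∖ W_f'`, realised inside the stable closure of `φ_f` (all of whose forms are
   `θ_f`-eigen for the `Z(𝔤)`-character `θ_f` of `φ_f`, Langlands' cyclicity argument), has the unitary
   Satake pairs of `f` at `p ∤ N` and archimedean parameter `{(k-1)/2, (1-k)/2}`
   (`exists_cuspidalAutomorphicRepData_newform`).
2. **Rigidity** (Jacquet–Shalika 1981, Thm. 4.4, archimedean form, in the Borel–Jacquet datum model).
   Given `π` as in the fact, pass to clean models `π₀ = C / ⊥` of `π` and `P₀ = C_f / ⊥` of `P`
   realising the subquotients (`IsShiftRealisation`, Borel–Jacquet 1979, 5.7: `C ≅ W / W'`); they are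
   nearly equivalent (Vieta on the Satake pair, uniqueness of Satake parameters), hence **equal**
   (the tree's `CuspidalAutomorphicRepData.W_eq_of_isNearlyEquivalent_of_clean_of_smo`), so the archimedean
   parameter of `P` passes to `P₀ = π₀` and back to `π` (`IsShiftRealisation.hasArchParameter`,
   `IsShiftRealisation.hasArchParameter_of_clean`).

The equality of nearly equivalent clean cuspidal data is the tree's
`CuspidalAutomorphicRepData.W_eq_of_isNearlyEquivalent_of_clean_of_smo`
(`StrongMultiplicityOneRepDataAE`: the `W`-level strong multiplicity one for clean data from
`strong_multiplicity_one_gl_sphericalLevel n K` alone, the Borel–Jacquet Satake dictionary being read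
only at almost every place, where it is the theorem `hasSatakeParamAt_iff_L2_eventually`). So the one
remaining input is strong multiplicity one for `GL₂` over `ℚ` in the `L²` model at the local spherical
levels, `strong_multiplicity_one_gl_sphericalLevel 2 ℚ` (Jacquet–Shalika 1981, Thm. 4.4, with
multiplicity one; Getz–Hahn 2024, Thm. 11.7.2 and 11.3.4), a named fact of `JacquetLanglandsParts`
proved in the tree for `n ≤ 1` only:

* `exists_cuspidalAutomorphicRepData_newform` — half 1;
* `newform_archParameter_of_smo` — **`strong_multiplicity_one_gl_sphericalLevel 2 ℚ → newform_archParameter`**.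

The discharge `newform_archParameter_holds` is `newform_archParameter_of_smo h` for a proof `h` of
`strong_multiplicity_one_gl_sphericalLevel 2 ℚ`, once it exists.

## References

* S. Gelbart, *Three lectures on the modularity of `ρ̄_{E,3}` and the Langlands reciprocity
  conjecture*, in: Modular Forms and Fermat's Last Theorem (1997), §2.5, Proposition, Remark 2.5.2,
  Fact 2.2. [Gelbart1997]
* S. Gelbart, *Automorphic forms on adele groups*, Ann. of Math. Stud. 83 (1975), §3, Prop. 3.1,
  Lemma 3.7, Thm. 5.19. [Gelbart1975]
* H. Jacquet, J. A. Shalika, *On Euler products and the classification of automorphic forms II*,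
  Amer. J. Math. 103 (1981), Thm. 4.4. [JacquetShalika1981]
* A. Borel, H. Jacquet, *Automorphic forms and automorphic representations*, Proc. Sympos. Pure
  Math. 33 (1979), part 1, §4.2, 4.4, 4.6, 5.7. [BorelJacquet1979]
-/

noncomputable section

open scoped MatrixGroups NNReal Classical Polynomial
open NumberField IsDedekindDomain MeasureTheory Filter Polynomial

namespace Literature.NumberTheory.Automorphic

open AdelicGroupData

/-! ### Equality of Borel–Jacquet data -/

section Ext

variable {n : ℕ} {K : Type} [Field K] [NumberField K] {hcpt : isCompact_glFiniteIntegralLevel n K}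

/-- Two Borel–Jacquet data on `GL_n(𝔸_K)` with the same spaces `W` and `W'` are equal (the other
fields of `AutomorphicRepData` are propositions). [folklore] -/
private theorem repData_eq_of_W_eq' {π π' : AutomorphicRepData (AutomorphyDatum.gl n K hcpt)}
    (hW : π.W = π'.W) (hW' : π.W' = π'.W') : π = π' := by
  cases π
  cases π'
  dsimp only at hW hW'
  subst hW
  subst hW'
  rfl

end Ext

/-! ### The dictionary `f ↦ π_f` at the archimedean place (Gelbart 1997, Prop. 2.5 (c)) -/

section Newform

open EllipticCurves.ModularForms CongruenceSubgroup Rat.HeightOneSpectrum GL2Real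

variable {hcpt : isCompact_glFiniteIntegralLevel 2 ℚ} {N : ℕ} [NeZero N] {k : ℤ}

/-- For a newform, `T_p f = a_p(f) f` at every prime `p` (the eigenvalue `heckeEigenvalue f p` is, by
definition, the scalar of the eigen-equation `IsHeckeEigenform` provides). [folklore] -/
theorem heckeT_eq_heckeEigenvalue_smul_of_isNewform1 {f : CuspForm (Gamma1 N) k} (hf : IsNewform1 f)
    (p : ℕ) (hp : p.Prime) :
    (haveI : NeZero p := ⟨hp.ne_zero⟩; EllipticCurves.ModularForms.heckeT (Gamma1 N) k p f) =
      heckeEigenvalue f p • f := by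
  haveI : NeZero p := ⟨hp.ne_zero⟩
  exact heckeT_eq_heckeEigenvalue_smul f p (hf.2.1 p hp)

set_option maxHeartbeats 800000 in
/-- **Half 1 of the printed proof: a cuspidal automorphic representation of the newform `f` with its
Satake pairs and its archimedean parameter** (Gelbart 1997, Prop. 2.5 (b), (c), (2.5.1), (2.5.4) (v)
and Remark 2.5.2; Gelbart 1975, §3 and Thm. 5.19). For a newform `f ∈ S_k(Γ₁(N))` there is a cuspidal
datum `P = W_f / W_f'` of `GL₂(𝔸_ℚ)` such that (i) at every `v` over `p ∤ N`, `P` has a Satake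
parameter `α` with `∏_{a ∈ α} (X - a) = X² - a_p p^{(1-k)/2} X + χ_f(p)` (the unitary normalisation
(2.5.1)), and (ii) `P` has archimedean parameter `{(k-1)/2, (1-k)/2}`. Proof: `φ_f` is a non-zero cusp
form (`adelicLiftFunA_mem_cuspFormsGL`, `adelicLiftFunA_ne_zero`) with a `Z(𝔤)`-character `θ_f`
(`Rat.hasZCharacter_of_casimir_of_zed`:
Casimir `((k-1)/2)² + ((1-k)/2)² - ½`, `sum_lieDeriv_single_adelicLiftFunA'`, and `Z φ_f = 0`,
`lieDeriv_one_adelicLiftFunA`); inside the stable closure of `φ_f` — all of whose forms are `θ_f`-eigen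
(`hasZCharacter_of_mem_W_ofCuspForm`, Langlands' cyclicity) — `exists_cuspidalAutomorphicRepData_satake_of_eigenform`
gives `P` with `φ_f ∈ W_f ∖ W_f'` and (i) (the newform identities `T_p f = a_p f`, `⟨d⟩ f = χ_f(d) f`:
`IsNewform1.mem_nebentypusSubspace_nebentypus_holds`); `Z(𝔤)` acts on `W_f / W_f'` by `θ_f`
(`hasInfinitesimalCharacter_lieRep_of_forall_hasZCharacter`), and (ii) is
`hasArchParameter_of_hasInfinitesimalCharacter_of_casimir_of_zed` read on `φ_f`.
[cite: Gelbart1997, §2.5 Proposition (b), (c), (2.5.1) and Remark 2.5.2] [cite: Gelbart1975, Thm. 5.19] -/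
theorem exists_cuspidalAutomorphicRepData_newform (f : CuspForm (Gamma1 N) k) (hf : IsNewform1 f) :
    ∃ P : CuspidalAutomorphicRepData 2 ℚ hcpt,
      (∀ v : HeightOneSpectrum (𝓞 ℚ), ¬ ((primesEquiv v : Nat.Primes) : ℕ) ∣ N →
        ∃ α : Multiset ℂ, P.1.HasSatakeParamAt v α ∧
          satakePolynomial α =
            X ^ 2 - C (heckeEigenvalue f ((primesEquiv v : Nat.Primes) : ℕ) *
              (((Real.sqrt ((primesEquiv v : Nat.Primes) : ℕ) : ℝ) : ℂ) ^ (1 - k))) * X +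
              C (nebentypus f ((((primesEquiv v : Nat.Primes) : ℕ) : ℕ) : ZMod N))) ∧
      P.1.HasArchParameter fun _ => ({(((k : ℤ) : ℂ) - 1) / 2, (1 - ((k : ℤ) : ℂ)) / 2} : Multiset ℂ) := by
  have hφ : adelicLiftFunA N k f ∈ cuspFormsGL 2 ℚ hcpt := adelicLiftFunA_mem_cuspFormsGL f hcpt
  have hf0 : f ≠ 0 := hf.ne_zero
  have hφ0 : adelicLiftFunA N k f ≠ 0 := adelicLiftFunA_ne_zero hf0
  -- the `Z(𝔤)`-character of `φ_f`
  have hs : IsArchSmooth (AutomorphyDatum.gl 2 ℚ hcpt).ofArch (adelicLiftFunA N k f) :=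
    isArchSmooth_ofArch_adelicLiftFunA_cuspForm f
  have hC := sum_lieDeriv_single_adelicLiftFunA' (N := N) (k := k) f
  have hZ : lieDeriv Rat.iotaA (toLie 1) (adelicLiftFunA N k f) =
      ((((k : ℤ) : ℂ) - 1) / 2 + (1 - ((k : ℤ) : ℂ)) / 2) • adelicLiftFunA N k f := by
    rw [lieDeriv_one_adelicLiftFunA, show (((k : ℤ) : ℂ) - 1) / 2 + (1 - ((k : ℤ) : ℂ)) / 2 = 0 by ring,
      zero_smul]
  obtain ⟨θ, hθ⟩ := Rat.hasZCharacter_of_casimir_of_zed hs hC hZ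
  -- the datum, inside the stable closure of `φ_f`
  obtain ⟨P, hPW, hPW', hle, hsat⟩ := exists_cuspidalAutomorphicRepData_satake_of_eigenform
    (CuspidalAutomorphicRepData.ofCuspForm hφ hφ0).1.stable (CuspidalAutomorphicRepData.ofCuspForm hφ hφ0).2
    f hf0 (CuspidalAutomorphicRepData.mem_W_ofCuspForm hφ hφ0) (nebentypus f)
    (IsNewform1.mem_nebentypusSubspace_nebentypus_holds hf) (heckeEigenvalue f)
    (fun p hp _ => heckeT_eq_heckeEigenvalue_smul_of_isNewform1 hf p hp)
  refine ⟨P, hsat, ?_⟩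
  have hθP : Automorphic.HasInfinitesimalCharacter P.1.lieRep θ :=
    P.1.hasInfinitesimalCharacter_lieRep_of_forall_hasZCharacter fun ψ hψ =>
      CuspidalAutomorphicRepData.hasZCharacter_of_mem_W_ofCuspForm hφ hφ0 hθ (hle hψ)
  exact P.1.hasArchParameter_of_hasInfinitesimalCharacter_of_casimir_of_zed hθP hPW hPW' hC hZ

/-- Vieta for a Satake pair: `∏_{a ∈ {α, β}} (X - a) = X² - (α + β) X + αβ` (the expanded form of
the tree's `satakePolynomial_pair`). [folklore] -/
theorem satakePolynomial_pair_eq_sq_sub (α β : ℂ) :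
    satakePolynomial {α, β} = X ^ 2 - C (α + β) * X + C (α * β) := by
  rw [satakePolynomial_pair, map_add, map_mul]
  ring

end Newform

/-! ### The reduction of `newform_archParameter` to strong multiplicity one for `GL₂` over `ℚ` -/

section Main

open EllipticCurves.ModularForms CongruenceSubgroup Rat.HeightOneSpectrum GL2Real

/-- **`newform_archParameter` from strong multiplicity one for `GL₂/ℚ`** (Gelbart 1997, §2.5
Proposition (c) and Remark 2.5.2, "the independence of the realisation is strong multiplicity one",
Jacquet–Shalika 1981, Thm. 4.4). Granting `strong_multiplicity_one_gl_sphericalLevel 2 ℚ` (the `L²`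
form at the local spherical levels), for a newform `f ∈ S_k(Γ₁(N))`, `k ≥ 2`, every cuspidal datum `π`
on `GL₂(𝔸_ℚ)` whose Satake parameter at almost every `p` is the unitary Satake pair of `f` has
archimedean parameter `{(k-1)/2, (1-k)/2}`. Proof. Let `P` be the datum of `f`
(`exists_cuspidalAutomorphicRepData_newform`: Satake pairs of `f` at `p ∤ N`, archimedean parameter
`{(k-1)/2, (1-k)/2}`), and `π₀ = C / ⊥`, `P₀ = C_f / ⊥` clean models of `π`, `P` realising the
subquotients (`exists_isShiftRealisation_of_sSup_irreducible`, with the proved semisimplicity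
`stable_cuspidal_eq_sSup_irreducible_holds`). At almost every `v` both `π₀` and `P₀` are unramified
(`hasSatakeParamAt_cofinite_holds`), their Satake parameters are Satake parameters of `π`, `P`
(`IsShiftRealisation.hasSatakeParamAt`), hence both equal `{α, β}` (uniqueness
`hasSatakeParamAt_unique_holds`; Vieta `satakePolynomial_pair_eq_sq_sub` and `roots_satakePolynomial` on the
side of `P`): `π₀`, `P₀` are nearly equivalent, so `C = C_f`
(`W_eq_of_isNearlyEquivalent_of_clean_of_smo` of `StrongMultiplicityOneRepDataAE`, for an automorphic measure,
`exists_isAutomorphicMeasure_gl_holds`), i.e. `π₀ = P₀`; the archimedean parameter of `P` passes to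
`P₀` (`IsShiftRealisation.hasArchParameter`) and back from `π₀` to `π`
(`IsShiftRealisation.hasArchParameter_of_clean`). [cite: Gelbart1997, §2.5 Proposition (c), Remark 2.5.2 and Fact 2.2]
[cite: Gelbart1975, Thm. 5.19] [cite: JacquetShalika1981, Thm. 4.4] -/
theorem newform_archParameter_of_smo (hsmo : strong_multiplicity_one_gl_sphericalLevel 2 ℚ) :
    newform_archParameter := by
  intro N _ k _ f hf hcpt π hπ
  classical
  -- the datum of `f`
  obtain ⟨P, hPsat, hParch⟩ := exists_cuspidalAutomorphicRepData_newform (hcpt := hcpt) f hf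
  -- clean models realising the subquotients
  obtain ⟨π₀, μ, j, M, hR⟩ :=
    π.exists_isShiftRealisation_of_sSup_irreducible AutomorphicRepsGL.stable_cuspidal_eq_sSup_irreducible_holds
  obtain ⟨P₀, μ', j', M', hR'⟩ :=
    P.exists_isShiftRealisation_of_sSup_irreducible AutomorphicRepsGL.stable_cuspidal_eq_sSup_irreducible_holds
  -- the clean models are nearly equivalent
  have h𝔫 : (Ideal.span {(N : 𝓞 ℚ)} : Ideal (𝓞 ℚ)) ≠ 0 := Rat.span_natCast_ne_zero N
  have hne : π₀.1.IsNearlyEquivalent P₀.1 := by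
    have c1 : ∀ᶠ v : HeightOneSpectrum (𝓞 ℚ) in cofinite, π₀.1.IsUnramifiedAt v :=
      AutomorphicRepData.hasSatakeParamAt_cofinite_holds π₀.1
    have c2 : ∀ᶠ v : HeightOneSpectrum (𝓞 ℚ) in cofinite, P₀.1.IsUnramifiedAt v :=
      AutomorphicRepData.hasSatakeParamAt_cofinite_holds P₀.1
    have c3 : ∀ᶠ v : HeightOneSpectrum (𝓞 ℚ) in cofinite, ¬ v.asIdeal ∣ Ideal.span {(N : 𝓞 ℚ)} :=
      (Ideal.finite_factors h𝔫).compl_mem_cofinite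
    have hπ' : ∀ᶠ v : HeightOneSpectrum (𝓞 ℚ) in cofinite,
        ∃ α β : ℂ, π.1.HasSatakeParamAt v {α, β} ∧
          α + β = heckeEigenvalue f (primesEquiv v) /
              (((Real.sqrt (primesEquiv v : ℕ) : ℝ) : ℂ) ^ (k - 1)) ∧
          α * β = nebentypus f (primesEquiv v : ℕ) := hπ
    filter_upwards [hπ', c1, c2, c3] with v hv h1 h2 h3
    obtain ⟨α, β, hαβ, hsum, hprod⟩ := hv
    obtain ⟨γ, hγ⟩ := h1
    obtain ⟨γ', hγ'⟩ := h2
    have h3' : ¬ ((primesEquiv v : Nat.Primes) : ℕ) ∣ N := fun h =>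
      h3 ((Rat.natGenerator_dvd_iff v N).1 h)
    obtain ⟨αv, hαv, hpoly⟩ := hPsat v h3'
    have e1 : γ = {α, β} := AutomorphicRepData.hasSatakeParamAt_unique_holds π.1 (hR.hasSatakeParamAt hγ) hαβ
    have e2 : γ' = αv := AutomorphicRepData.hasSatakeParamAt_unique_holds P.1 (hR'.hasSatakeParamAt hγ') hαv
    have hsqrt : (((Real.sqrt ((primesEquiv v : Nat.Primes) : ℕ) : ℝ) : ℂ)) ≠ 0 := by
      rw [Ne, Complex.ofReal_eq_zero]
      exact (Real.sqrt_pos.2 (by exact_mod_cast (primesEquiv v : Nat.Primes).2.pos)).ne'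
    have e3 : αv = {α, β} := by
      have hp2 : satakePolynomial {α, β} = satakePolynomial αv := by
        rw [hpoly, satakePolynomial_pair_eq_sq_sub, hsum, hprod, div_eq_mul_inv, ← zpow_neg, neg_sub]
      have := congrArg Polynomial.roots hp2
      rwa [roots_satakePolynomial, roots_satakePolynomial, eq_comm] at this
    exact ⟨{α, β}, e1 ▸ hγ, (e2.trans e3) ▸ hγ'⟩
  -- strong multiplicity one on the clean models: `C = C_f`, `π₀ = P₀`
  obtain ⟨μm, hμm⟩ := AdelicGroupData.exists_isAutomorphicMeasure_gl_holds 2 ℚ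
  haveI := hμm
  have hW : π₀.1.W = P₀.1.W :=
    CuspidalAutomorphicRepData.W_eq_of_isNearlyEquivalent_of_clean_of_smo (μm := μm) hsmo π₀ P₀
      hR.bot hR'.bot hne
  have heq : π₀ = P₀ := Subtype.ext (repData_eq_of_W_eq' hW (hR.bot.trans hR'.bot.symm))
  -- transfer of the archimedean parameter `P → P₀ = π₀ → π`
  have h0 : π₀.1.HasArchParameter fun _ => ({(((k : ℤ) : ℂ) - 1) / 2, (1 - ((k : ℤ) : ℂ)) / 2} : Multiset ℂ) := by
    rw [heq]
    exact hR'.hasArchParameter hParch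
  exact hR.hasArchParameter_of_clean h0

end Main

end Literature.NumberTheory.Automorphic
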